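import Summits.BirchSwinnertonDyer.Rank1Residual.Additive.CensusX42BSD
import Summits.BirchSwinnertonDyer.Rank1Residual.AdditivePotMult.PotMultRankOneKatoCertificateBSD
import Summits.BirchSwinnertonDyer.Rank1Residual.AdditivePotMult.PotMultRankOneWuthrichCertificate
import HarnessLib

/-!
# Census relation X4-2: the ONE-NODE theorem on the (M) rows (potentially multiplicative, `E♭`
# multiplicative at `p`) — the typed census relation AT THE PAIR + the one-number (M) branch
# certificate + Kato's (resp. Wuthrich's) divisibility + a Delbourgo (B)-datum ⟹ `BSD(E,p)`, EVERY odd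
# `p` (sequel of `CensusX42BSD.lean`; cell `b2b-bsdres`, census cell `bsd-formula-census`, seat
# `b2b-bsdres-census-ctyper1` = conjecture-typer 1, gen 3; consumes n1011-p07's T-O7KM files by name)

HONEST FRAMING (cell `b2b-bsdres`, run/shared/lean/b2b/bsd-rank1-residual/, verbatim in every
file): the goal of the cell is to DELETE the COMBINATION-SHAPED residual classes of the
Birch–Swinnerton-Dyer formula for ALL analytic-rank `≤ 1` elliptic curves over `ℚ` — "full BSD
formula for every rank `≤ 1` curve in class `C`" assembled STRICTLY from published theorems — so
that the rank-`≤ 1` remainder becomes exactly the CONSTRUCTION-SHAPED classes, which are TYPED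
(missing-input `Prop`s), NOT attempted. This is not "finishing BSD". Census cell
(bsd-formula-census): research instrumentation; census output = EVIDENCE / conjecture items for the
kernel cell, never a Literature fact; `r = 0` cells CALIBRATION, `r = 1` cells CANDIDATE = EVIDENCE,
never a cited fact; nothing here 'confirms' anything; labels / RESIDUAL-MAP marks UNCHANGED (O7
OPEN, X4(M) / X3♯(M) CONSTRUCTION-SHAPED); nothing booked. THEOREMS ONLY (no definition, no named
fact); every statement is CONDITIONAL on the named published facts in its binders (Kato 2004 Thm.
17.4 (3) half-eigen reading `hK` / Wuthrich 2014 Thm. 16 `hW16`, Delbourgo 2002 (B) via a (B)-datum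
`hB`, modularity, GZK), on n1011-p07's one-number certificate `MultBranchUnitCertificateAt W p`, and on
the TYPED CENSUS RELATION `CensusX42.RelationAt W p Dh` AT THE PAIR (CANDIDATE; X42-REPORT.md sha256
`e8592c9a2e1a59c13e754928288c9f6b1ce554f7ffb80b93db3c55aa7f5e9950`, LEADERBOARD config
`d256dfff9e867754` (M): blind survivor `A′/(h·C) = α♭⁻¹·c_∞(E)` with `α♭ := ã = a_p(E♭) = ±1`,
train 360/360, held-out 198/198; EVIDENCE block in `CensusX42LeadingTerm.lean`).

## What

n1011-p07 (T-O7KM, `AdditivePotMult/PotMultRankOneKatoCertificate[BSD].lean`) and n1011-p12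
(`PotMultRankOneWuthrichCertificate.lean`) proved on X4(M) ∩ {`ρ̄` onto} resp. X3♯(M), EVERY odd `p`,
`r_an = 1`: the divisibility + the one-number (M) certificate (`c₀ = 0 ∧ ‖[T¹](ϖ·L^±_p(f, ã, ω^{(p−1)/2}))‖ = 1`)
+ a (B)-datum `Dh` give the exact identity and `BSD(E,p) ⟺ ord_p q + ord_p Reg_p(E,Dh) = 1` — with NO
`ℓ`, NO `5 ≤ p`, NO anomalous binder. The (M) clauses of `CensusX42.RelationAt W p Dh` read
`ϖ·[T¹]L^±·log_p γ·#T² = ã⁻¹ (·c_∞) · #Ш_an · Reg_p(Dh) · ∏c` with `ã = a_p(E♭) = ±1` (`‖ã‖ = 1`); the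
bookkeeping of `CensusX42BSD.lean` §1 turns it into `ord_p q + ord_p Reg_p(Dh) = 1` on a certified row.
Hence `ClassX4M.bsdp_of_censusX42_of_katoHalf_of_multCert` / `ClassX3M.bsdp_of_censusX42_of_wuthrichHalf_of_multCert`:
the census relation AT THE PAIR + certificate + half + (B)-datum ⟹ `BSD(E,p)` on the 558 (M) rows'
classes (X4(M) needs `ρ̄` onto). ON THE HEIGHT DATUM: as in `CensusX42BSD.lean` — one `Dh` carrying
both hypotheses; that the census height on the (M) rows (PARI `ellpadicheight`, plain Tate `s₂`
transported from `E♭`) is Delbourgo's `⟨,⟩_{p,ℚ}` is a READING flagged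
`MT-mult-height-comparison-unread` by rmap-2 g9 (requests.jsonl l.1502 (2)) — never asserted here.

References: D. Delbourgo, J. Number Theory 95 (2002) Thm. (A), (B) [Delbourgo2002]; K. Kato,
Astérisque 295 (2004) Thm. 17.4 (3) [Kato2004Asterisque]; C. Wuthrich, Doc. Math. 19 (2014) Thm. 16
[Wuthrich2014]; B. Mazur, J. Tate, J. Teitelbaum, Invent. Math. 84 (1986) §I.10, §I.13
[MazurTateTeitelbaum1986Invent]; R. L. Miller, LMS J. Comput. Math. 14 (2011) Def. 1.1
[Miller2011LMS]; census files of record (module docstring of `CensusX42LeadingTerm.lean`).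
-/

noncomputable section

open scoped Classical MatrixGroups ModularForm NumberField

namespace Summit.BirchSwinnertonDyer.Rank1Residual.Additive.CensusX42

open CongruenceSubgroup WeierstrassCurve NumberField Literature.NumberTheory.EllipticCurves
  Literature.NumberTheory.EllipticCurves.ModularForms
  Literature.NumberTheory.EllipticCurves.Rank1Residual
  Literature.NumberTheory.EllipticCurves.Rank1Residual.Typed
  Literature.NumberTheory.EllipticCurves.Delbourgo2002
  IsDedekindDomain

variable {p : ℕ} [hp : Fact p.Prime]

/-! ### §5 (M) bookkeeping: `ã = a_p(E♭) = ±1` is a unit, and the (M) clause's valuation -/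

/-- At a multiplicative prime `a_p(V) = ±1`, so `ã⁻¹ = (a_p(V))⁻¹ ∈ ℚ_p` is non-zero of valuation `0`.
[cite: MazurTateTeitelbaum1986Invent, §I.10] -/
theorem intCast_LFunction_inv_ne_zero_and_valuation {V : WeierstrassCurve ℚ} [V.IsElliptic]
    [V.IsGloballyMinimal] {N : ℕ} [NeZero N] {f : CuspForm (Gamma0 N) 2} (hf : IsNewformOf V f)
    (hV : Mult V p) :
    (((V.LFunction p : ℤ)) : ℚ_[p])⁻¹ ≠ 0 ∧ ((((V.LFunction p : ℤ)) : ℚ_[p])⁻¹).valuation = 0 := by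
  have hcoef : cuspCoeff f p = ((V.LFunction p : ℤ) : ℂ) := hf.2 p
  have hpm : (V.LFunction p : ℤ) = 1 ∨ (V.LFunction p : ℤ) = -1 := by
    by_cases hs : V.HasSplitMultiplicativeReductionAtPrime p
    · obtain ⟨h1, -⟩ := hf.cuspCoeff_eq_one_and_sq_of_split hs
      left
      have h : ((V.LFunction p : ℤ) : ℂ) = ((1 : ℤ) : ℂ) := by rw [← hcoef, h1, Int.cast_one]
      exact_mod_cast h
    · obtain ⟨h1, -⟩ := hf.cuspCoeff_eq_neg_one_and_dvd_of_nonsplit hV hs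
      right
      have h : ((V.LFunction p : ℤ) : ℂ) = ((-1 : ℤ) : ℂ) := by
        rw [← hcoef, h1, Int.cast_neg, Int.cast_one]
      exact_mod_cast h
  have hnorm : ‖(((V.LFunction p : ℤ)) : ℚ_[p])‖ = 1 := by
    rcases hpm with h | h <;> rw [h] <;> simp
  obtain ⟨h0, hv⟩ := valuation_eq_zero_of_norm_eq_one hnorm
  exact ⟨inv_ne_zero h0, by rw [Padic.valuation_inv, hv, neg_zero]⟩

/-- **Core of the (M) one-node theorem (cell-agnostic): on a row carrying the (M) certificate, the
census relation at the pair reads `ord_p q + ord_p Reg_p(E,Dh) = 1`.** For `W = E` globally minimal,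
additive at the odd prime `p`, of analytic rank `1`, `L'(E,1) = q·Ω_E·Reg_∞(E)` (`q ≠ 0`), a globally
minimal `V` MULTIPLICATIVE at `p` with `C • V^{(p*)} = W`, a newform `f` of `V` and the period ratio
`ϖ` of the parity of `(p−1)/2`: if `‖[T¹](ϖ·L^±_p(f, ã, ω^{(p−1)/2}))‖ = 1` (`hone`, `ã = a_p(V)`) and
`CensusX42.RelationAt W p Dh` holds, then `Reg_p(E,Dh) ≠ 0` and `ord_p q + ord_p Reg_p(E,Dh) = 1`.
[cite: MazurTateTeitelbaum1986Invent, §I.10, §I.13] [cite: Iwasawa1972PadicL, §4.4] -/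
theorem padicValRat_add_valuation_eq_one_of_relationAt_mult (hp2 : p ≠ 2)
    {W : WeierstrassCurve ℚ} [W.IsElliptic] [W.IsGloballyMinimal] (hadd : Addv W p)
    (hr : W.analyticRank = 1) {q : ℚ} (hq : q ≠ 0)
    (hLq : W.leadingLCoeff = (q : ℂ) * (W.realPeriodRat : ℂ) * (W.regulator : ℂ))
    (V : WeierstrassCurve ℚ) [V.IsElliptic] [V.IsGloballyMinimal] (C : VariableChange ℚ)
    (hC : C • V.quadraticTwist ((-1 : ℚ) ^ (p / 2) * p) = W) (hV : Mult V p)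
    {N : ℕ} [NeZero N] {f : CuspForm (Gamma0 N) 2} (hf : IsNewformOf V f)
    (ϖ : ℚ) (hϖ : if Even (p / 2) then (ϖ : ℝ) * V.realPeriodRat = plusPeriod f
      else (ϖ : ℝ) * V.imaginaryPeriodRat = minusPeriod f)
    (hone : ‖PowerSeries.coeff 1 (PowerSeries.C (ϖ : ℚ_[p]) *
        (if Even (p / 2) then padicLFunctionPlusBranchMult f (((V.LFunction p : ℤ)) : ℚ_[p]) (p / 2)
          else padicLFunctionMinusBranchMult f (((V.LFunction p : ℤ)) : ℚ_[p]) (p / 2)))‖ = 1)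
    {Dh : PAdicHeightData W p} (hrel : RelationAt W p Dh) :
    padicRegulator Dh ≠ 0 ∧ padicValRat p q + (padicRegulator Dh).valuation = 1 := by
  have hs := shaAn_eq_of_leadingLCoeff_eq W hLq
  obtain ⟨heven, hodd⟩ := hrel V C f hadd (Or.inr hV) hf hr _ hs
  obtain ⟨hℓ0, hℓ⟩ := X2.valuation_padicLog_cyclotomicGenerator (p := p) hp2
  obtain ⟨hu0, hu⟩ := intCast_LFunction_inv_ne_zero_and_valuation (p := p) hf hV
  have hodd4 : p % 4 = 1 ∨ p % 4 = 3 := by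
    obtain ⟨k, hk⟩ := hp.out.odd_of_ne_two hp2
    omega
  rcases hodd4 with h1 | h3
  · -- `p ≡ 1 (mod 4)`: even one-term branch, `κ = 1`
    have hev : Even (p / 2) := ⟨p / 4, by omega⟩
    have hC' : C • V.quadraticTwist (p : ℚ) = W := by
      rw [pStar_eq_of_mod_four p (Or.inl h1), if_pos h1] at hC; exact hC
    rw [if_pos hev] at hϖ hone
    rw [PowerSeries.coeff_C_mul] at hone
    obtain ⟨-, -, hid⟩ := (heven h1 hC' ϖ hϖ).2 hV
    refine padicValRat_add_valuation_eq_one_of_identity (W := W) hq hone hℓ0 hℓ hu0 hu one_ne_zero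
      Padic.valuation_one ?_
    rw [mul_one]
    exact hid
  · -- `p ≡ 3 (mod 4)`: odd one-term branch, `κ = c_∞(E)`
    have hnev : ¬ Even (p / 2) := by rw [Nat.not_even_iff_odd]; exact ⟨p / 4, by omega⟩
    have hC' : C • V.quadraticTwist (-(p : ℚ)) = W := by
      rw [pStar_eq_of_mod_four p (Or.inr h3), if_neg (by omega)] at hC; exact hC
    rw [if_neg hnev] at hϖ hone
    rw [PowerSeries.coeff_C_mul] at hone
    obtain ⟨-, -, hid⟩ := (hodd h3 hC' ϖ hϖ).2 hV
    obtain ⟨hκ0, hκ⟩ := numRealComponents_cast_ne_zero_and_valuation (p := p) hp2 W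
    exact padicValRat_add_valuation_eq_one_of_identity (W := W) hq hone hℓ0 hℓ hu0 hu hκ0 hκ hid

end Summit.BirchSwinnertonDyer.Rank1Residual.Additive.CensusX42

namespace Summit.BirchSwinnertonDyer.Rank1Residual.AdditivePotMult

open CongruenceSubgroup WeierstrassCurve NumberField Literature.NumberTheory.EllipticCurves
  Literature.NumberTheory.EllipticCurves.ModularForms
  Literature.NumberTheory.EllipticCurves.Rank1Residual
  Literature.NumberTheory.EllipticCurves.Rank1Residual.Typed
  Literature.NumberTheory.EllipticCurves.Delbourgo2002
  Literature.NumberTheory.GaloisRepresentations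
  Summit.BirchSwinnertonDyer.Rank1Residual.Additive
  Summit.BirchSwinnertonDyer.Rank1Residual.Additive.CensusX42
  IsDedekindDomain

variable {W : WeierstrassCurve ℚ} [W.IsElliptic] [W.IsGloballyMinimal] {p : ℕ} [hp : Fact p.Prime]

/-! ### §6 X4(M) ∩ {`ρ̄` onto} and X3♯(M), EVERY odd `p`: census relation at the pair ⟹ `BSD(E,p)` -/

/-- **ONE NODE on the (M) rows, big image (X4(M) ∩ {`ρ̄_{E,p}` onto}, EVERY odd `p`, `r_an = 1`).**
Given Kato's half-eigen divisibility (`hK`), modularity (`hmodD`, `hmod`), GZK, n1011-p07's one-number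
(M) certificate `MultBranchUnitCertificateAt W p` (the census's `v_p(A′) = 1` (M) rows), a height
datum `Dh` with Delbourgo's (B)-clauses (`hB`) and `L'(E,1) = q·Ω_E·Reg_∞` (`hLq`): **the typed census
relation `CensusX42.RelationAt W p Dh` AT THE PAIR implies `BSD(E,p)`** — by p07's
`ClassX4M.bsdp_iff_padicVal_rankOne_of_katoHalf_of_multCert` and the (M) bookkeeping (§5). No `ℓ`,
no `5 ≤ p`, no anomalous binder. CONDITIONAL on `hrel` (CANDIDATE relation, EVIDENCE only).
[cite: Kato2004Asterisque, Thm. 17.4 (3) (p. 273)] [cite: Delbourgo2002, Theorem (B) (p. 40)]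
[cite: Miller2011LMS, Def. 1.1] -/
theorem ClassX4M.bsdp_of_censusX42_of_katoHalf_of_multCert
    (hK : Wuthrich2014.kato_halfEigenCharIdeal_dvd_cyclotomicPrime_of_surjective)
    (hmodD : nonempty_modularParametrizationData)
    (hGZK : rank_eq_analyticRank_of_analyticRank_le_one) (hmod : hasEntireLFunction_rat)
    (hX : ClassX4M W p) (hsurj : Surj W p) (hr : W.analyticRank = 1)
    (hcert : MultBranchUnitCertificateAt W p)
    {Dh : PAdicHeightData W p} (hB : LeadingTermClauses W p Dh) (hrel : CensusX42.RelationAt W p Dh)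
    {q : ℚ} (hLq : W.leadingLCoeff = (q : ℂ) * (W.realPeriodRat : ℂ) * (W.regulator : ℂ)) :
    BSDp W p := by
  rw [hX.bsdp_iff_padicVal_rankOne_of_katoHalf_of_multCert hK hmodD hGZK hmod hsurj hr hcert hB hLq]
  have hp2 : p ≠ 2 := hX.p_ne_two
  have hq : q ≠ 0 := by
    rintro rfl
    rw [Rat.cast_zero, zero_mul, zero_mul] at hLq
    exact W.leadingLCoeff_ne_zero_holds (hmod W) hLq
  obtain ⟨V, iV, iVm, C, hV, hC⟩ := hX.exists_mult_pStar_twist_model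
  haveI : NeZero (V.conductorNorm ℤ) := ⟨(V.conductorNorm_pos_holds).ne'⟩
  obtain ⟨Dm⟩ := hmodD V
  obtain ⟨ϖ, hϖ⟩ := exists_periodRatio_parity (p := p) V Dm
  obtain ⟨-, hone⟩ := hcert V C hV hC Dm.f Dm.isNewformOf (V.LFunction p) (Dm.isNewformOf.2 p) ϖ hϖ
  exact (CensusX42.padicValRat_add_valuation_eq_one_of_relationAt_mult hp2 hX.classX4.2.1 hr hq hLq
    V C hC hV Dm.isNewformOf ϖ hϖ hone hrel).2

/-- **ONE NODE on the (M) rows, reducible `E[p]` (X3♯(M), EVERY odd `p`, `r_an = 1`):** Wuthrich's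
half-eigen divisibility (`hW16`), modularity, GZK, the one-number (M) certificate, a (B)-datum `Dh`,
`L'(E,1) = q·Ω_E·Reg_∞`, and the typed census relation `CensusX42.RelationAt W p Dh` AT THE PAIR ⟹
`BSD(E,p)` — by n1011-p12's `ClassX3M.bsdp_iff_padicVal_rankOne_of_wuthrichHalf_of_multCert` and §5.
No image / tower / `5 ≤ p` / CM / anomalous binder. CONDITIONAL on `hrel` (CANDIDATE; EVIDENCE only).
[cite: Wuthrich2014, Thm. 16 (p. 397)] [cite: Delbourgo2002, Theorem (B) (p. 40)]
[cite: Miller2011LMS, Def. 1.1] -/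
theorem ClassX3M.bsdp_of_censusX42_of_wuthrichHalf_of_multCert
    (hW16 : Wuthrich2014.thm16_halfEigenCharIdeal_dvd_cyclotomicPrime)
    (hmodD : nonempty_modularParametrizationData)
    (hGZK : rank_eq_analyticRank_of_analyticRank_le_one) (hmod : hasEntireLFunction_rat)
    (hX : ClassX3M W p) (hr : W.analyticRank = 1) (hcert : MultBranchUnitCertificateAt W p)
    {Dh : PAdicHeightData W p} (hB : LeadingTermClauses W p Dh) (hrel : CensusX42.RelationAt W p Dh)
    {q : ℚ} (hLq : W.leadingLCoeff = (q : ℂ) * (W.realPeriodRat : ℂ) * (W.regulator : ℂ)) :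
    BSDp W p := by
  rw [hX.bsdp_iff_padicVal_rankOne_of_wuthrichHalf_of_multCert hW16 hmodD hGZK hmod hr hcert hB hLq]
  have hp2 : p ≠ 2 := ClassX3M.p_ne_two W p hX
  have hq : q ≠ 0 := by
    rintro rfl
    rw [Rat.cast_zero, zero_mul, zero_mul] at hLq
    exact W.leadingLCoeff_ne_zero_holds (hmod W) hLq
  obtain ⟨V, iV, iVm, C, hV, hC⟩ := hX.exists_mult_pStar_twist_model
  haveI : NeZero (V.conductorNorm ℤ) := ⟨(V.conductorNorm_pos_holds).ne'⟩
  obtain ⟨Dm⟩ := hmodD V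
  obtain ⟨ϖ, hϖ⟩ := exists_periodRatio_parity (p := p) V Dm
  obtain ⟨-, hone⟩ := hcert V C hV hC Dm.f Dm.isNewformOf (V.LFunction p) (Dm.isNewformOf.2 p) ϖ hϖ
  exact (CensusX42.padicValRat_add_valuation_eq_one_of_relationAt_mult hp2 (ClassX3M.classX3 W p hX).2
    hr hq hLq V C hC hV Dm.isNewformOf ϖ hϖ hone hrel).2

/-- **ONE NODE on the (M) rows from published facts + the certificate + the census relation alone**
(X4(M) ∩ {`ρ̄` onto}, EVERY odd `p`, `r_an = 1`; no CM / `5 ≤ p` binder — Delbourgo 2002 (M) has every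
hypothesis discharged on (M), n1011-p16's `ClassX4M.delbourgo2002`): Kato 17.4 (3) (`hK`), Delbourgo
2002 (A)+(B) at potentially multiplicative reduction (`hDelM` = `Delbourgo2002.mainTheorem_potMult`,
supplying THE (B)-datum), Gross–Zagier I.(7.3) (`hGZ`), GZK, modularity, the one-number (M)
certificate, and `CensusX42.RelationAt W p Dh` for EVERY (B)-datum `Dh` (`hrel`) ⟹ `BSD(E,p)`.
[cite: Kato2004Asterisque, Thm. 17.4 (3) (p. 273)] [cite: Delbourgo2002, Theorem (A), (B) (p. 40)]
[cite: GrossZagier1986, Thm. I.(7.3)] [cite: Miller2011LMS, Def. 1.1] -/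
theorem ClassX4M.bsdp_of_forall_censusX42_of_katoHalf_of_multCert
    (hDelM : Delbourgo2002.mainTheorem_potMult)
    (hK : Wuthrich2014.kato_halfEigenCharIdeal_dvd_cyclotomicPrime_of_surjective)
    (hGZ : GrossZagier1986_thm_I_7_3) (hmodD : nonempty_modularParametrizationData)
    (hGZK : rank_eq_analyticRank_of_analyticRank_le_one) (hmod : hasEntireLFunction_rat)
    (hX : ClassX4M W p) (hsurj : Surj W p) (hr : W.analyticRank = 1)
    (hcert : MultBranchUnitCertificateAt W p)
    (hrel : ∀ Dh : PAdicHeightData W p, LeadingTermClauses W p Dh → CensusX42.RelationAt W p Dh) :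
    BSDp W p := by
  obtain ⟨-, Dh, hB⟩ := hX.delbourgo2002 hDelM
  obtain ⟨q, -, hLq⟩ := CensusX42.exists_leadingLCoeff_eq_of_grossZagier hGZ hGZK W hr
  exact hX.bsdp_of_censusX42_of_katoHalf_of_multCert hK hmodD hGZK hmod hsurj hr hcert hB (hrel Dh hB)
    hLq

end Summit.BirchSwinnertonDyer.Rank1Residual.AdditivePotMult

end
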